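import Summits.AtomisticToContinuum.FouriersLaw.Theorems.PhononMeanFreePathDefs
import Summits.AtomisticToContinuum.FouriersLaw.Theorems.IncoherentChannel.Negative.LineResistance

/-!
# Crux-strategist sketch — crux `PhononMeanFreePath.IncoherentChannel` (stmt-AtomisticToContinuum-11811)

Typed objects behind `STRATEGY-CENSUS.md` (planner-cstrat-stmt-AtomisticToContinuum-11811-s1-0, 2026-08-17).
Nothing here is a route item or a registered stub; the file only certifies that the census's
signatures elaborate and that the cheap glue it mentions is real.

* `incSeq`  — the crux sequence `i_N = N(γ²/T²)∫₀^∞ (C_N − 2 r_N²)` (incoherent / cumulant channel);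
* `kuboSeq` — the Kubo-form total `a_N = N(γ²/T²)∫₀^∞ C_N = D_{N+1}` (`fouriersLaw_iff_kuboForm`);
* DECOMPOSITION (D1): `IncoherentConverges ∧ IncoherentFloor ↔ IncoherentChannel` (both directions proved);
* STRENGTHEN (S1): `MonotoneScaledConductance` (eventually nondecreasing `a_N`) — with an `N`-uniform bound it
  gives convergence of `a_N` (`kuboConverges_of_monotone_of_bounded`, proved);
* STRENGTHEN (S2): `HydrodynamicCumulantProfile` (diffusive-scaling dominated-convergence form), signature only;
* NEGATION: `not_incoherentChannel_iff_not_fouriersLaw_of_coherentDephasing` — under the route's rank-2 crux a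
  counterexample to the crux is a counterexample to the conjunct (from the landed `Negative.LineResistance`).
-/

noncomputable section

namespace Summit.AtomisticToContinuum.FouriersLaw.Cruxes.IncoherentChannel.Strategist

open MeasureTheory Set Filter Topology
open Literature.MathematicalPhysics.KineticTheory.HeatConduction
open Summit.AtomisticToContinuum.FouriersLaw.Theses.PhononMeanFreePath (IncoherentChannel CoherentDephasing)
open Summit.AtomisticToContinuum.FouriersLaw.Theorems.PhononMeanFreePath
open Summit.AtomisticToContinuum.FouriersLaw.Theorems.IncoherentChannel.Negative.LineResistance
  (incoherentChannel_iff_fouriersLaw_of_coherentDephasing)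

/-- The crux sequence (incoherent channel) `i_N = N(γ²/T²)∫₀^∞ (C_N − 2 r_N²) dt`. -/
def incSeq (ω₂ lam β γ T : ℝ) (N : ℕ) : ℝ :=
  (N : ℝ) * (γ ^ 2 / T ^ 2) *
    ∫ t in Ioi (0 : ℝ), (powerCov ω₂ lam β γ T N t - 2 * (pairCorr ω₂ lam β γ T N t) ^ 2)

/-- The Kubo-form total scaled conductance `a_N = N(γ²/T²)∫₀^∞ C_N dt` (`= D_{N+1}` by `BoundaryKubo`). -/
def kuboSeq (ω₂ lam β γ T : ℝ) (N : ℕ) : ℝ :=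
  (N : ℝ) * (γ ^ 2 / T ^ 2) * ∫ t in Ioi (0 : ℝ), powerCov ω₂ lam β γ T N t

/-- `incSeq` is the sequence printed in the crux. -/
theorem incSeq_eq (ω₂ lam β γ T : ℝ) (N : ℕ) :
    incSeq ω₂ lam β γ T N = (N : ℝ) * (γ ^ 2 / T ^ 2) * ∫ t in Ioi (0 : ℝ),
      ((∫ z, (z.2 0) ^ 2 * (∫ y, (y.2 (Fin.last N)) ^ 2
          ∂((pinnedChain ω₂ lam β γ).transitionKernel (N + 1) T T t.toNNReal z))
          ∂((pinnedChain ω₂ lam β γ).gibbsMeasure (N + 1) T)) -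
        (∫ z, (z.2 0) ^ 2 ∂((pinnedChain ω₂ lam β γ).gibbsMeasure (N + 1) T)) *
          (∫ z, (∫ y, (y.2 (Fin.last N)) ^ 2
            ∂((pinnedChain ω₂ lam β γ).transitionKernel (N + 1) T T t.toNNReal z))
            ∂((pinnedChain ω₂ lam β γ).gibbsMeasure (N + 1) T)) -
        2 * (∫ z, z.2 0 * (∫ y, y.2 (Fin.last N)
          ∂((pinnedChain ω₂ lam β γ).transitionKernel (N + 1) T T t.toNNReal z))
          ∂((pinnedChain ω₂ lam β γ).gibbsMeasure (N + 1) T)) ^ 2) := by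
  simp only [incSeq, cruxIntegrand_eq]

/-- The crux in the vocabulary of this file (definitional). -/
theorem incoherentChannel_iff_incSeq :
    IncoherentChannel ↔ ∀ ω₂ lam β γ : ℝ, 0 < ω₂ → 0 < lam → 0 < β → 0 < γ → ∀ T : ℝ, 0 < T →
      ∃ κ : ℝ, 0 < κ ∧ Tendsto (incSeq ω₂ lam β γ T) atTop (𝓝 κ) := by
  simp only [IncoherentChannel, funext (incSeq_eq _ _ _ _ _)]

/-! ## (D1) Decomposition: existence of the limit / positive floor -/

/-- **D1, piece 1 — the cumulant channel CONVERGES** (to some real limit; TRUE at the harmonic corner,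
where `i_N ≡ 0` by the Wick identity `Negative.HarmonicWick`). -/
def IncoherentConverges : Prop :=
  ∀ ω₂ lam β γ : ℝ, 0 < ω₂ → 0 < lam → 0 < β → 0 < γ → ∀ T : ℝ, 0 < T →
    ∃ L : ℝ, Tendsto (incSeq ω₂ lam β γ T) atTop (𝓝 L)

/-- **D1, piece 2 — the cumulant channel has a POSITIVE FLOOR** (`liminf_N i_N > 0`; FALSE at the harmonic
corner; with `CoherentDephasing` it is `JunctionLocality.ConductanceLowerBound`, stmt-11749, in channel form). -/
def IncoherentFloor : Prop :=
  ∀ ω₂ lam β γ : ℝ, 0 < ω₂ → 0 < lam → 0 < β → 0 < γ → ∀ T : ℝ, 0 < T →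
    ∃ c : ℝ, 0 < c ∧ ∀ᶠ N in atTop, c ≤ incSeq ω₂ lam β γ T N

/-- Glue of D1 (sorry-free): limit + positive floor ⇒ the crux. -/
theorem incoherentChannel_of_converges_of_floor (h₁ : IncoherentConverges) (h₂ : IncoherentFloor) :
    IncoherentChannel := by
  rw [incoherentChannel_iff_incSeq]
  intro ω₂ lam β γ hω hl hβ hγ T hT
  obtain ⟨L, hL⟩ := h₁ ω₂ lam β γ hω hl hβ hγ T hT
  obtain ⟨c, hc, hev⟩ := h₂ ω₂ lam β γ hω hl hβ hγ T hT
  exact ⟨L, lt_of_lt_of_le hc (ge_of_tendsto hL hev), hL⟩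

/-- Converse: the crux gives both pieces, so D1 is an EXACT split (nothing is lost or added). -/
theorem converges_and_floor_of_incoherentChannel (h : IncoherentChannel) :
    IncoherentConverges ∧ IncoherentFloor := by
  rw [incoherentChannel_iff_incSeq] at h
  refine ⟨fun ω₂ lam β γ hω hl hβ hγ T hT => ?_, fun ω₂ lam β γ hω hl hβ hγ T hT => ?_⟩
  · obtain ⟨κ, -, hκ⟩ := h ω₂ lam β γ hω hl hβ hγ T hT
    exact ⟨κ, hκ⟩
  · obtain ⟨κ, hκpos, hκ⟩ := h ω₂ lam β γ hω hl hβ hγ T hT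
    refine ⟨κ / 2, by positivity, ?_⟩
    have : ∀ᶠ N in atTop, incSeq ω₂ lam β γ T N ∈ Ioi (κ / 2) :=
      hκ (Ioi_mem_nhds (by linarith))
    exact this.mono fun N hN => le_of_lt hN

theorem incoherentChannel_iff_converges_and_floor :
    IncoherentChannel ↔ IncoherentConverges ∧ IncoherentFloor :=
  ⟨converges_and_floor_of_incoherentChannel, fun h => incoherentChannel_of_converges_of_floor h.1 h.2⟩

/-! ## (S1) Strengthen: monotone scaled conductance -/

/-- **S1 — eventually nondecreasing scaled conductance** `a_N ≤ a_{N+1}` for `N ≥ N₀` (per-bond resistance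
`R_{N+1}/(N+1)·` never increases: a Rayleigh-type monotonicity law). -/
def MonotoneScaledConductance : Prop :=
  ∀ ω₂ lam β γ : ℝ, 0 < ω₂ → 0 < lam → 0 < β → 0 < γ → ∀ T : ℝ, 0 < T →
    ∃ N₀ : ℕ, ∀ N : ℕ, N₀ ≤ N → kuboSeq ω₂ lam β γ T N ≤ kuboSeq ω₂ lam β γ T (N + 1)

/-- What the added rigidity buys (real analysis only): eventual monotonicity + an `N`-uniform upper bound
⇒ the total Kubo sequence converges. Positivity of the limit would come from `a_{N₀} > 0`
(`JunctionLocality.PositiveConductance`, proved) — so S1 + `BoundedResponse` is the whole conjunct. -/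
theorem kuboConverges_of_monotone_of_bounded {ω₂ lam β γ T : ℝ} {N₀ : ℕ} {B : ℝ}
    (hmono : ∀ N : ℕ, N₀ ≤ N → kuboSeq ω₂ lam β γ T N ≤ kuboSeq ω₂ lam β γ T (N + 1))
    (hbdd : ∀ N : ℕ, kuboSeq ω₂ lam β γ T N ≤ B) :
    ∃ L : ℝ, Tendsto (kuboSeq ω₂ lam β γ T) atTop (𝓝 L) := by
  set b : ℕ → ℝ := fun n => kuboSeq ω₂ lam β γ T (n + N₀) with hb
  have hbm : Monotone b := monotone_nat_of_le_succ fun n => by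
    simp only [hb]
    have := hmono (n + N₀) (Nat.le_add_left _ _)
    simpa [Nat.add_right_comm] using this
  have hbb : BddAbove (range b) := ⟨B, by rintro _ ⟨n, rfl⟩; exact hbdd _⟩
  refine ⟨⨆ n, b n, ?_⟩
  have h := tendsto_atTop_ciSup hbm hbb
  exact (tendsto_add_atTop_iff_nat N₀).1 h

/-! ## (S2) Strengthen: diffusive-scaling profile (dominated convergence form) -/

/-- **S2 — hydrodynamic profile of the cumulant channel**: in diffusive scaling `t = N²τ` the rescaled
integrand `N³(γ²/T²)(C_N − 2r_N²)(N²τ)` converges pointwise to a profile `Φ` with `∫Φ > 0` under an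
`N`-uniform integrable envelope `g` (then `i_N = ∫ N³(…)(N²τ)dτ → ∫Φ` by dominated convergence). -/
def HydrodynamicCumulantProfile : Prop :=
  ∀ ω₂ lam β γ : ℝ, 0 < ω₂ → 0 < lam → 0 < β → 0 < γ → ∀ T : ℝ, 0 < T →
    ∃ Φ g : ℝ → ℝ, IntegrableOn g (Ioi 0) ∧ 0 < ∫ τ in Ioi (0 : ℝ), Φ τ ∧
      (∀ (N : ℕ) (τ : ℝ), 0 < τ →
        |(N : ℝ) ^ 3 * (γ ^ 2 / T ^ 2) * (powerCov ω₂ lam β γ T N ((N : ℝ) ^ 2 * τ) -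
          2 * (pairCorr ω₂ lam β γ T N ((N : ℝ) ^ 2 * τ)) ^ 2)| ≤ g τ) ∧
      ∀ τ : ℝ, 0 < τ → Tendsto (fun N : ℕ => (N : ℝ) ^ 3 * (γ ^ 2 / T ^ 2) *
          (powerCov ω₂ lam β γ T N ((N : ℝ) ^ 2 * τ) - 2 * (pairCorr ω₂ lam β γ T N ((N : ℝ) ^ 2 * τ)) ^ 2))
        atTop (𝓝 (Φ τ))

/-! ## Negation: under the rank-2 crux a counterexample to the crux is a counterexample to the conjunct -/

/-- The typed obstruction to the negation lens (landed `Negative.LineResistance`, which rests on the proved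
`NessUnique_holds`, `boundaryKubo_proof`): given `CoherentDephasing`, `¬ IncoherentChannel ↔ ¬ FouriersLaw`. -/
theorem not_incoherentChannel_iff_not_fouriersLaw_of_coherentDephasing (hA : CoherentDephasing) :
    ¬ IncoherentChannel ↔ ¬ _root_.FouriersLaw :=
  not_congr (incoherentChannel_iff_fouriersLaw_of_coherentDephasing hA)

end Summit.AtomisticToContinuum.FouriersLaw.Cruxes.IncoherentChannel.Strategist

end
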